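import Summits.HodgeConjecture.HodgeConjecture.Theorems.AnchorTransportVariationalHodgePadicGrothendieckExistenceUnitSections
import Literature.AlgebraicGeometry.Morphisms.SectionsBaseChangeSurjective
import Literature.AlgebraicGeometry.Morphisms.CechH1Pullback

/-!
# Unit bounds at one level: passage to the closed subscheme `Spec A/𝔞 ⊆ Spec A` (GW II 24.105 (II))

Helper file toward row b03 / crux `AnchorTransport.VariationalHodge` (stmt-HodgeConjecture-1076), line
padic-disc-transport, STUB P (`…_of_grothendieckExistence` rungs), continuing
`…GrothendieckExistenceUnitSections`. Step (II) of Görtz–Wedhorn II Lemma 24.105 compares, for a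
`B/bⁿ⁺¹`-module `M_n` (a level of a formal tower on `Spec B`), the unit of `π : X' → Spec B` at
`M_n~` with the unit of the base change `π̃ : X̃' → Spec B̂` at `M_n~`, through "`K_n ⊗ B̂/(JB̂)ⁿ⁺¹`,
which can be identified with `K_n` since `B̂/(JB̂)ⁿ⁺¹ = B/Jⁿ⁺¹`" (p. 575). On the tree's carriers both
comparisons are instances of ONE statement, proved here: for a ring map `φ : A ↠ A₀` whose kernel
is contained in `(s)`, a morphism `p : P → Spec A`, a cartesian square
`(i, p₀) : X₀ = P ×_{Spec A} Spec A₀`, and an affine-localizing `𝒪_{Spec A}`-module `N` killed by `s`: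

* `isKilledBy_ker_spec_map`, `isKilledBy_ker_of_isPullback` — `N` is killed by the kernel ideal of
  `j = Spec φ`, and `p^*N` by the kernel ideal of `i` (Stacks 02KG: `ker i♯ = (ker φ)·Γ`,
  `Morphisms/SectionsBaseChangeSurjective`);
* **`level_bound_up`, `level_bound_down`** — for `r ∈ Γ(Spec A, 𝒪)`: `r` kills the kernel of the
  unit `Γ(N) → Γ(P, p^*N)` and multiplies `Γ(P, p^*N)` into its image **iff** `j♯(r)` does so for
  the unit `Γ(j^*N) → Γ(X₀, p₀^*j^*N)` (the units of the closed immersions `j`, `i` at `N`, `p^*N` are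
  isomorphisms, Stacks 01QY; `…UnitSections.unit_app_baseChange`).

HONEST FRAMING: research route conditional on HC_CM; not a corollary; Q11.4-sentence-2 already
refuted in dim ≥ 3. Nothing here bears on `HC_CM`; no case of the Hodge conjecture is proved.

References: GortzWedhorn2023 (II: Lemma 24.105 (II), p. 574–575); StacksProject (Tags 01QY, 02KG).
-/

set_option linter.dupNamespace false

noncomputable section

-- Summit.HodgeConjecture.HodgeConjecture.… repeats the summit name by the D-0017 layout (Sub = Summit).

-- `TopCat.Presheaf`/`Scheme.Modules` are not reducible (as in Mathlib's `AlgebraicGeometry/Modules`).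
set_option backward.isDefEq.respectTransparency false

open CategoryTheory CategoryTheory.Limits AlgebraicGeometry TopologicalSpace Opposite
open Literature.AlgebraicGeometry.Modules Literature.AlgebraicGeometry.Morphisms
open Literature.AlgebraicGeometry.Motives

universe u

namespace Summit.HodgeConjecture.HodgeConjecture.Theorems

namespace GrothendieckExistenceProper

section Level

variable {A A₀ : Type u} [CommRing A] [CommRing A₀] (φ : A →+* A₀) (hφ : Function.Surjective φ)
  {P X₀ : Scheme.{u}} (p : P ⟶ Spec (.of A)) {i : X₀ ⟶ P} {p₀ : X₀ ⟶ Spec (.of A₀)}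
  (H : IsPullback i p₀ p (Spec.map (CommRingCat.ofHom φ)))
  (N : (Spec (.of A)).Modules) {s : A} (hs : RingHom.ker φ ≤ Ideal.span {s})
  (hNs : globalScalar N (algebraMapΓ (𝟙 _) s) = 0)

include hφ in
/-- `Spec φ` is a closed immersion for `φ` surjective. -/
theorem isClosedImmersion_spec_map : IsClosedImmersion (Spec.map (CommRingCat.ofHom φ)) :=
  IsClosedImmersion.spec_of_surjective _ hφ

include hφ hs hNs in
/-- **`N` is killed by the kernel ideal of `j = Spec φ`** when `N` is killed by `s` and
`ker φ ⊆ (s)`: on an affine `V`, `ker (j♯_V) = (ker φ)·Γ(V) ⊆ (s|_V)`. -/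
theorem isKilledBy_ker_spec_map : IsKilledBy (Spec.map (CommRingCat.ofHom φ)).ker N := by
  intro V r hr m
  rw [Scheme.Hom.ker_apply] at hr
  have Hsq : IsPullback (Spec.map (CommRingCat.ofHom φ)) (𝟙 _) (𝟙 (Spec (.of A)))
      (Spec.map (CommRingCat.ofHom φ)) :=
    IsPullback.of_vert_isIso ⟨by rw [Category.id_comp, Category.comp_id]⟩
  have hr' := mem_map_ker_of_app_eq_zero φ (𝟙 _) hφ Hsq V.2 (r : Sections (𝟙 (Spec (.of A))) V) hr
  obtain ⟨c, hc⟩ : ∃ c : Γ(Spec (.of A), V),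
      c * (Spec (.of A)).presheaf.map (homOfLE (le_top : (V : (Spec (.of A)).Opens) ≤ ⊤)).op
        (algebraMapΓ (𝟙 _) s) = r := by
    have h := Ideal.map_mono (f := algebraMap A (Sections (𝟙 (Spec (.of A))) V)) hs hr'
    rw [Ideal.map_span, Set.image_singleton] at h
    exact Ideal.mem_span_singleton'.mp h
  rw [← hc, mul_smul, ← globalScalar_app_apply, hNs, Scheme.Modules.Hom.zero_app]
  exact smul_zero c

include hφ H hs hNs in
/-- **`p^*N` is killed by the kernel ideal of `i`** (`i` the base change of `j = Spec φ` along `p`):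
on an affine `W ⊆ P`, `ker (i♯_W) = (ker φ)·Γ(W) ⊆ (p♯(s)|_W)`, and `p^*(s·) = p♯(s)·` kills
`p^*N`. -/
theorem isKilledBy_ker_of_isPullback : IsKilledBy i.ker ((Scheme.Modules.pullback p).obj N) := by
  haveI := isClosedImmersion_spec_map φ hφ
  haveI : IsClosedImmersion i := MorphismProperty.of_isPullback H.flip inferInstance
  intro W r hr m
  rw [Scheme.Hom.ker_apply] at hr
  have hr' := mem_map_ker_of_app_eq_zero φ p hφ H W.2 (r : Sections p W) hr
  obtain ⟨c, hc⟩ : ∃ c : Γ(P, W),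
      c * P.presheaf.map (homOfLE (le_top : (W : P.Opens) ≤ ⊤)).op (algebraMapΓ p s) = r := by
    have h := Ideal.map_mono (f := algebraMap A (Sections p W)) hs hr'
    rw [Ideal.map_span, Set.image_singleton] at h
    exact Ideal.mem_span_singleton'.mp h
  have hkill : globalScalar ((Scheme.Modules.pullback p).obj N) (algebraMapΓ p s) = 0 := by
    rw [← Sections.appTop_algebraMapΓ (𝟙 _) p p (Category.comp_id p) s, ← pullback_map_globalScalar,
      hNs, Functor.map_zero]
  rw [← hc, mul_smul, ← globalScalar_app_apply, hkill, Scheme.Modules.Hom.zero_app]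
  exact smul_zero c

include hφ H hs hNs in
/-- **Level comparison, upwards**: if `r ∈ Γ(Spec A, 𝒪)` kills the kernel of the unit
`Γ(N) → Γ(P, p^*N)` and multiplies `Γ(P, p^*N)` into its image, then `j♯(r)` does so for the unit
`Γ(j^*N) → Γ(X₀, p₀^*j^*N)`, `j = Spec φ` (`N` affine-localizing killed by `s ⊇ ker φ`, `p^*N`
affine-localizing). -/
theorem level_bound_up (hN : IsAffineLocalizing N)
    (hF : IsAffineLocalizing ((Scheme.Modules.pullback p).obj N)) {r : Γ(Spec (.of A), ⊤)}
    (hk : ∀ m : Γ(N, ⊤), ((Scheme.Modules.pullbackPushforwardAdjunction p).unit.app N).app ⊤ m = 0 →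
      r • m = 0)
    (hi : ∀ t : Γ((Scheme.Modules.pushforward p).obj ((Scheme.Modules.pullback p).obj N), ⊤),
      ∃ m : Γ(N, ⊤), ((Scheme.Modules.pullbackPushforwardAdjunction p).unit.app N).app ⊤ m = r • t) :
    (∀ m' : Γ((Scheme.Modules.pullback (Spec.map (CommRingCat.ofHom φ))).obj N, ⊤),
      ((Scheme.Modules.pullbackPushforwardAdjunction p₀).unit.app
        ((Scheme.Modules.pullback (Spec.map (CommRingCat.ofHom φ))).obj N)).app ⊤ m' = 0 →
      (Spec.map (CommRingCat.ofHom φ)).appTop r • m' = 0) ∧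
    (∀ t' : Γ((Scheme.Modules.pushforward p₀).obj ((Scheme.Modules.pullback p₀).obj
        ((Scheme.Modules.pullback (Spec.map (CommRingCat.ofHom φ))).obj N)), ⊤),
      ∃ m' : Γ((Scheme.Modules.pullback (Spec.map (CommRingCat.ofHom φ))).obj N, ⊤),
        ((Scheme.Modules.pullbackPushforwardAdjunction p₀).unit.app
          ((Scheme.Modules.pullback (Spec.map (CommRingCat.ofHom φ))).obj N)).app ⊤ m' =
        (Spec.map (CommRingCat.ofHom φ)).appTop r • t') := by
  haveI := isClosedImmersion_spec_map φ hφ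
  haveI : IsClosedImmersion i := MorphismProperty.of_isPullback H.flip inferInstance
  have hK := isKilledBy_ker_spec_map φ hφ N hs hNs
  have hKi := isKilledBy_ker_of_isPullback φ hφ p H N hs hNs
  exact bound_of_square_up ((Spec.map (CommRingCat.ofHom φ)).app ⊤).hom
    (fun m => ((Scheme.Modules.pullbackPushforwardAdjunction p).unit.app N).app ⊤ m)
    (fun m' => ((Scheme.Modules.pullbackPushforwardAdjunction p₀).unit.app
      ((Scheme.Modules.pullback (Spec.map (CommRingCat.ofHom φ))).obj N)).app
        ((Spec.map (CommRingCat.ofHom φ)) ⁻¹ᵁ ⊤) m')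
    (fun m => ((Scheme.Modules.pullbackPushforwardAdjunction (Spec.map (CommRingCat.ofHom φ))).unit.app
      N).app ⊤ m)
    (fun t => ((Scheme.Modules.pullback p₀).obj ((Scheme.Modules.pullback
        (Spec.map (CommRingCat.ofHom φ))).obj N)).presheaf.map
        (homOfLE (preimage_preimage_eq_of_comp_eq p (Spec.map (CommRingCat.ofHom φ)) i p₀ H.w ⊤).ge).op
      ((((Scheme.Modules.pullbackPushforwardAdjunction i).unit.app
          ((Scheme.Modules.pullback p).obj N)) ≫
        (Scheme.Modules.pushforward i).map
          ((Scheme.Modules.pullbackComp i p).hom.app N ≫ (Scheme.Modules.pullbackCongr H.w).hom.app N ≫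
            (Scheme.Modules.pullbackComp p₀ (Spec.map (CommRingCat.ofHom φ))).inv.app N)).app (p ⁻¹ᵁ ⊤) t))
    (fun r m => Scheme.Modules.Hom.app_smul _ r m)
    (fun r t => baseChange_app_smul p (Spec.map (CommRingCat.ofHom φ)) i p₀ H.w N ⊤ r t)
    (fun m => unit_app_baseChange p (Spec.map (CommRingCat.ofHom φ)) i p₀ H.w N ⊤ m)
    (unit_app_bijective_of_isKilledBy_ker _ N hN hK (isAffineOpen_top _)).2
    (baseChange_app_bijective p (Spec.map (CommRingCat.ofHom φ)) i p₀ H.w N ⊤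
      (unit_app_bijective_of_isClosedImmersion i ((Scheme.Modules.pullback p).obj N) hF hKi (p ⁻¹ᵁ ⊤)))
    hk hi

include hφ H hs hNs in
/-- **Level comparison, downwards**: conversely, if `j♯(r)` kills the kernel of the unit
`Γ(j^*N) → Γ(X₀, p₀^*j^*N)` and multiplies `Γ(X₀, p₀^*j^*N)` into its image, then `r` does so for
the unit `Γ(N) → Γ(P, p^*N)`. -/
theorem level_bound_down (hN : IsAffineLocalizing N)
    (hF : IsAffineLocalizing ((Scheme.Modules.pullback p).obj N)) {r : Γ(Spec (.of A), ⊤)}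
    (hk : ∀ m' : Γ((Scheme.Modules.pullback (Spec.map (CommRingCat.ofHom φ))).obj N, ⊤),
      ((Scheme.Modules.pullbackPushforwardAdjunction p₀).unit.app
        ((Scheme.Modules.pullback (Spec.map (CommRingCat.ofHom φ))).obj N)).app ⊤ m' = 0 →
      (Spec.map (CommRingCat.ofHom φ)).appTop r • m' = 0)
    (hi : ∀ t' : Γ((Scheme.Modules.pushforward p₀).obj ((Scheme.Modules.pullback p₀).obj
        ((Scheme.Modules.pullback (Spec.map (CommRingCat.ofHom φ))).obj N)), ⊤),
      ∃ m' : Γ((Scheme.Modules.pullback (Spec.map (CommRingCat.ofHom φ))).obj N, ⊤),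
        ((Scheme.Modules.pullbackPushforwardAdjunction p₀).unit.app
          ((Scheme.Modules.pullback (Spec.map (CommRingCat.ofHom φ))).obj N)).app ⊤ m' =
        (Spec.map (CommRingCat.ofHom φ)).appTop r • t') :
    (∀ m : Γ(N, ⊤), ((Scheme.Modules.pullbackPushforwardAdjunction p).unit.app N).app ⊤ m = 0 →
      r • m = 0) ∧
    (∀ t : Γ((Scheme.Modules.pushforward p).obj ((Scheme.Modules.pullback p).obj N), ⊤),
      ∃ m : Γ(N, ⊤), ((Scheme.Modules.pullbackPushforwardAdjunction p).unit.app N).app ⊤ m = r • t) := by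
  haveI := isClosedImmersion_spec_map φ hφ
  haveI : IsClosedImmersion i := MorphismProperty.of_isPullback H.flip inferInstance
  have hK := isKilledBy_ker_spec_map φ hφ N hs hNs
  have hKi := isKilledBy_ker_of_isPullback φ hφ p H N hs hNs
  exact bound_of_square_down ((Spec.map (CommRingCat.ofHom φ)).app ⊤).hom
    (fun m => ((Scheme.Modules.pullbackPushforwardAdjunction p).unit.app N).app ⊤ m)
    (fun m' => ((Scheme.Modules.pullbackPushforwardAdjunction p₀).unit.app
      ((Scheme.Modules.pullback (Spec.map (CommRingCat.ofHom φ))).obj N)).app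
        ((Spec.map (CommRingCat.ofHom φ)) ⁻¹ᵁ ⊤) m')
    (fun m => ((Scheme.Modules.pullbackPushforwardAdjunction (Spec.map (CommRingCat.ofHom φ))).unit.app
      N).app ⊤ m)
    (fun t => ((Scheme.Modules.pullback p₀).obj ((Scheme.Modules.pullback
        (Spec.map (CommRingCat.ofHom φ))).obj N)).presheaf.map
        (homOfLE (preimage_preimage_eq_of_comp_eq p (Spec.map (CommRingCat.ofHom φ)) i p₀ H.w ⊤).ge).op
      ((((Scheme.Modules.pullbackPushforwardAdjunction i).unit.app
          ((Scheme.Modules.pullback p).obj N)) ≫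
        (Scheme.Modules.pushforward i).map
          ((Scheme.Modules.pullbackComp i p).hom.app N ≫ (Scheme.Modules.pullbackCongr H.w).hom.app N ≫
            (Scheme.Modules.pullbackComp p₀ (Spec.map (CommRingCat.ofHom φ))).inv.app N)).app (p ⁻¹ᵁ ⊤) t))
    (fun r m => Scheme.Modules.Hom.app_smul _ r m)
    (fun r t => baseChange_app_smul p (Spec.map (CommRingCat.ofHom φ)) i p₀ H.w N ⊤ r t)
    (fun m => unit_app_baseChange p (Spec.map (CommRingCat.ofHom φ)) i p₀ H.w N ⊤ m)
    (unit_app_bijective_of_isKilledBy_ker _ N hN hK (isAffineOpen_top _))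
    (baseChange_app_bijective p (Spec.map (CommRingCat.ofHom φ)) i p₀ H.w N ⊤
      (unit_app_bijective_of_isClosedImmersion i ((Scheme.Modules.pullback p).obj N) hF hKi
        (p ⁻¹ᵁ ⊤))).1
    hk hi

end Level

end GrothendieckExistenceProper

end Summit.HodgeConjecture.HodgeConjecture.Theorems

end
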